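import Summits.Ventures.GridStability.Lyapunov.PolyRecastLieChunks
import Literature.Computation.Certificates.KeyedPositivstellensatz
import HarnessLib

/-!
# GridStability/Lyapunov/PolyRecastKeyedLie — the `V̇ = lieDeriv F V` link decided in KEY SPACE (all-`ℕ` kernel arithmetic)

Cell `gridfusion` (LADDER-GRIDFUSION), `plan/PARTITION.md` §0 row `Lyapunov/` (generic glue, extending lyap-1's
`PolyRecast.lean` p482110 and sos-3's `PolyRecastLieChunks.lean`; seat gridfusion-lyap-2 (g2), for the 27-variable
NE39 «…Roa» companion of the K-STREAM kernel set `Bench/NE39KsVdotNeg*`). PURPOSE: the `SOS.Poly` links of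
`PolyRecast` / `PolyRecastLieChunks` compare exponent LISTS (27 entries per monomial at n = 10 machines) inside the
sorted merges — measured 2026-08-27 on the farm: ONE speed component `F_k · ∂_k V` of the NE39 certificate (51 × 28 raw
products) costs ≈ 36 s of kernel time in `Poly` arithmetic, the whole link ≈ 6 min, i.e. no single `decide`. This file
moves the link to the K-STREAM currency of `Literature/Computation/Certificates/Keyed*` (certnum-sdp-3 / lit-5):
Kronecker KEYS `keyOfMono b m ∈ ℕ` for monomials and SIGN–MAGNITUDE integer coefficients (`STerms`), so that every
comparison / product inside the kernel is one accelerated `ℕ` operation [cite: Harvey2009, §3.1]: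

* `prodS A B` — all products of two keyed term lists (keys add, signs multiply, magnitudes multiply); sound as a
  product of polynomials under carry-free digit bounds (`keysLe`, `monoEval_add`): `eval_prodS`;
* `mergeS` / `msortS` — merge sort by key (fuel-indexed; `eval`-invariant whatever the fuel: `eval_msortS`);
* `lieTermsK b n D₁ D₂ ΛA ΛB F V N` — for `k < N`: the keyed integer forms `keyedZ b ΛA (norm (∂_k V))` and
  `keyedZ b ΛB F_k` (digit bounds `polyOK` / `keysLe` CHECKED, not assumed) and their products, concatenated;
  `eval_lieTermsK`: it evaluates to `ΛA·ΛB·Σ_{k<N} (∂_k V)(x)·F_k(x)`;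
* `lieCheckK … F V Rp N` — the Boolean certificate: digit bounds, then `groupCheck (msortS (products ++ keyedZ b
  (ΛA·ΛB) Rp)) []` (the library's one-pass sorted group-sum walk against the EMPTY target: every key group sums to
  zero); **`eval_lieDeriv_eq_neg_of_lieCheckK`**: `lieCheckK … = true`, `numVars V = N`, `0 < ΛA·ΛB` ⇒
  `eval (lieDeriv F V) = − eval Rp` on every field of characteristic zero — the shape in which a Positivstellensatz
  target `Rp = p + ε φ` with `p = −V̇ − ε φ` is consumed (`p` in any term order, untrimmed exponent vectors allowed);
* `hasDerivWithinAt_eval_neg_of_lieCheckK` — the curve-form Lyapunov hypothesis along a coordinatewise solution,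
  drop-in for `hasDerivWithinAt_eval_of_isZero` / `_of_links` / `_of_merged`.

Pure bookkeeping (MODELLED/CERTIFIED columns untouched): no named fact, standard axioms; the `def`s are
computation-oriented twins of `SOS.Poly.lieDeriv` in the sense of data refinement [cite: MartinDorelRoux2017, §3];
coefficient matching by a sorted group-sum walk is [cite: BlekhermanParriloThomas2012, §3.1.4 eq. (3.12), p. 64].
-/

noncomputable section

open Set Filter Topology Finset
open Literature.Computation.Certificates Literature.Computation.Certificates.SOS
open Literature.Computation.Certificates.SOS.Keyed

namespace Summit.Ventures.GridStability.Lyapunov.PolyRecast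

/-! ### Keyed sign–magnitude arithmetic -/

/-- All products of two keyed sign–magnitude term lists: keys add (Kronecker codes of a product, carry-free under
digit bounds), signs multiply (`==` on `Bool`), magnitudes multiply. [cite: Harvey2009, §3.1] -/
def prodS (A B : STerms) : STerms :=
  A.flatMap fun t => B.map fun u => (t.1 + u.1, t.2.1 == u.2.1, t.2.2 * u.2.2)

/-- Every key of the list passes the digit bound `digitsLe b D n`. [cite: Harvey2009, §3.1] -/
def keysLe (b D n : ℕ) (T : STerms) : Bool :=
  T.all fun t => digitsLe b D n t.1

/-- Fuel-indexed merge of two key-sorted term lists (out of fuel: concatenation — still `eval`-sound). [folklore] -/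
def mergeS : ℕ → STerms → STerms → STerms
  | 0, A, B => A ++ B
  | _ + 1, [], B => B
  | _ + 1, t :: A, [] => t :: A
  | f + 1, t :: A, u :: B => if u.1 < t.1 then u :: mergeS f (t :: A) B else t :: mergeS f A (u :: B)

/-- Fuel-indexed merge sort by key (`O(T log T)` key comparisons, each one accelerated `ℕ` comparison). [folklore] -/
def msortS : ℕ → STerms → STerms
  | 0, T => T
  | _ + 1, [] => []
  | _ + 1, [t] => [t]
  | f + 1, t₁ :: t₂ :: rest =>
    mergeS (rest.length + 2) (msortS f ((t₁ :: t₂ :: rest).take ((rest.length + 2) / 2)))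
      (msortS f ((t₁ :: t₂ :: rest).drop ((rest.length + 2) / 2)))

/-- **Keyed Lie-derivative contributions**: for `k < N`, the integer keyed forms of `norm (∂_k V)` (scale `ΛA`) and
`F_k` (scale `ΛB`) — digit bounds `D₁`, `D₂` CHECKED — and all their products, concatenated (`none` if a scaling is
not integral or a bound fails). [cite: Harvey2009, §3.1] -/
def lieTermsK (b n D₁ D₂ ΛA ΛB : ℕ) (F : List Poly) (V : Poly) : ℕ → Option STerms
  | 0 => some []
  | k + 1 =>
    match lieTermsK b n D₁ D₂ ΛA ΛB F V k, keyedZ b ΛA (Poly.norm (Poly.pderiv k V)), keyedZ b ΛB (F.getD k []) with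
    | some acc, some A, some B =>
      if (polyOK D₁ n (Poly.norm (Poly.pderiv k V)) && polyOK D₂ n (F.getD k []) &&
          keysLe b D₁ n A && keysLe b D₂ n B) = true
      then some (prodS A B ++ acc) else none
    | _, _, _ => none

/-- **The keyed Lie-link certificate** for `lieDeriv F V = −Rp`: digit bounds, then the library's sorted group-sum
walk `groupCheck` of the merge-sorted contributions `products ++ keyedZ b (ΛA·ΛB) Rp` against the EMPTY target (every
key group sums to zero). One `decide +kernel` on numeral data. [cite: BlekhermanParriloThomas2012, §3.1.4 eq. (3.12), p. 64] -/
def lieCheckK (b n D₁ D₂ ΛA ΛB : ℕ) (F : List Poly) (V Rp : Poly) (N : ℕ) : Bool :=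
  decide (D₁ + D₂ < b) && polyOK (D₁ + D₂) n Rp &&
    match lieTermsK b n D₁ D₂ ΛA ΛB F V N, keyedZ b (ΛA * ΛB) Rp with
    | some E, some T => groupCheck (msortS (E.length + T.length) (E ++ T)) []
    | _, _ => false

/-! ### Soundness -/

section Sound

variable {R : Type*} [Field R] [CharZero R]

omit [CharZero R] in
/-- Signs multiply as `==` on `Bool`. [folklore] -/
theorem cast_sval_beq_mul (s₁ s₂ : Bool) (m₁ m₂ : ℕ) :
    ((sval (s₁ == s₂) (m₁ * m₂) : ℤ) : R) = ((sval s₁ m₁ : ℤ) : R) * ((sval s₂ m₂ : ℤ) : R) := by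
  cases s₁ <;> cases s₂ <;> simp [sval]

omit [CharZero R] in
/-- One term times a keyed list, under carry-free digit bounds. [cite: Harvey2009, §3.1] -/
theorem eval_map_mulTerm (x : ℕ → R) {b D₁ D₂ n : ℕ} (hD : D₁ + D₂ < b) {κ : ℕ} (sg : Bool) (m : ℕ)
    (hκ : digitsLe b D₁ n κ = true) :
    ∀ B : STerms, keysLe b D₂ n B = true →
      ZTerms.eval x b n (STerms.toZ (B.map fun u => (κ + u.1, sg == u.2.1, m * u.2.2))) =
        ((sval sg m : ℤ) : R) * monoEval x b n 0 κ * ZTerms.eval x b n (STerms.toZ B)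
  | [], _ => by simp
  | (k, s, m') :: B, h => by
    simp only [keysLe, List.all_cons, Bool.and_eq_true] at h
    rw [List.map_cons, STerms.toZ_cons, ZTerms.eval_cons, STerms.toZ_cons, ZTerms.eval_cons,
      monoEval_add x hD n 0 κ k hκ h.1, eval_map_mulTerm x hD sg m hκ B (by simpa [keysLe] using h.2),
      cast_sval_beq_mul]
    ring

omit [CharZero R] in
/-- **Products of keyed lists are products of polynomials** (carry-free digit bounds). [cite: Harvey2009, §3.1] -/
theorem eval_prodS (x : ℕ → R) {b D₁ D₂ n : ℕ} (hD : D₁ + D₂ < b) {B : STerms} (hB : keysLe b D₂ n B = true) :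
    ∀ A : STerms, keysLe b D₁ n A = true →
      ZTerms.eval x b n (STerms.toZ (prodS A B)) =
        ZTerms.eval x b n (STerms.toZ A) * ZTerms.eval x b n (STerms.toZ B)
  | [], _ => by simp [prodS]
  | (κ, sg, m) :: A, h => by
    simp only [keysLe, List.all_cons, Bool.and_eq_true] at h
    rw [prodS, List.flatMap_cons, toZ_append, ZTerms.eval_append, ← prodS,
      eval_prodS x hD hB A (by simpa [keysLe] using h.2), eval_map_mulTerm x hD sg m h.1 B hB,
      STerms.toZ_cons, ZTerms.eval_cons]
    ring

omit [CharZero R] in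
/-- The fuelled merge is `eval`-additive (any fuel, any order). [folklore] -/
theorem eval_mergeS (x : ℕ → R) (b n : ℕ) :
    ∀ (f : ℕ) (A B : STerms), ZTerms.eval x b n (STerms.toZ (mergeS f A B)) =
      ZTerms.eval x b n (STerms.toZ A) + ZTerms.eval x b n (STerms.toZ B)
  | 0, A, B => by rw [mergeS, toZ_append, ZTerms.eval_append]
  | _ + 1, [], B => by simp [mergeS]
  | _ + 1, t :: A, [] => by simp [mergeS]
  | f + 1, (k, s, m) :: A, (k', s', m') :: B => by
    rw [mergeS]
    split_ifs with hlt
    · rw [STerms.toZ_cons, ZTerms.eval_cons, eval_mergeS x b n f _ B, STerms.toZ_cons, ZTerms.eval_cons,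
        STerms.toZ_cons, ZTerms.eval_cons]
      ring
    · rw [STerms.toZ_cons, ZTerms.eval_cons, eval_mergeS x b n f A _, STerms.toZ_cons, ZTerms.eval_cons,
        STerms.toZ_cons, ZTerms.eval_cons]
      ring

omit [CharZero R] in
/-- Merge sort does not change `eval` (any fuel). [folklore] -/
theorem eval_msortS (x : ℕ → R) (b n : ℕ) :
    ∀ (f : ℕ) (T : STerms), ZTerms.eval x b n (STerms.toZ (msortS f T)) = ZTerms.eval x b n (STerms.toZ T)
  | 0, T => by rw [msortS]
  | _ + 1, [] => by rw [msortS]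
  | _ + 1, [t] => by rw [msortS]
  | f + 1, t₁ :: t₂ :: rest => by
    rw [msortS, eval_mergeS, eval_msortS x b n f, eval_msortS x b n f, ← ZTerms.eval_append, ← toZ_append,
      List.take_append_drop]

/-- **The contributions evaluate to `ΛA·ΛB·Σ_{k<N} (∂_k V)·F_k`.** [cite: RoucheHabetsLaloy1977, Ch. I §3.1 eq. (3.1)] -/
theorem eval_lieTermsK (x : ℕ → R) {b n D₁ D₂ ΛA ΛB : ℕ} (hD : D₁ + D₂ < b) (F : List Poly) (V : Poly) :
    ∀ (N : ℕ) {E : STerms}, lieTermsK b n D₁ D₂ ΛA ΛB F V N = some E →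
      ZTerms.eval x b n (STerms.toZ E) =
        (ΛA : R) * (ΛB : R) * ∑ k ∈ range N, Poly.eval x (Poly.mul (Poly.pderiv k V) (F.getD k []))
  | 0, E, h => by
    simp only [lieTermsK, Option.some.injEq] at h
    subst h; simp
  | N + 1, E, h => by
    unfold lieTermsK at h
    cases hrec : lieTermsK b n D₁ D₂ ΛA ΛB F V N with
    | none => rw [hrec] at h; exact absurd h (by simp)
    | some acc =>
      cases hA : keyedZ b ΛA (Poly.norm (Poly.pderiv N V)) with
      | none => rw [hrec, hA] at h; exact absurd h (by simp)
      | some A =>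
        cases hB : keyedZ b ΛB (F.getD N []) with
        | none => rw [hrec, hA, hB] at h; exact absurd h (by simp)
        | some B =>
          rw [hrec, hA, hB] at h
          simp only at h
          split_ifs at h with hc
          simp only [Option.some.injEq] at h
          subst h
          simp only [Bool.and_eq_true] at hc
          obtain ⟨⟨⟨hokA, hokB⟩, hkA⟩, hkB⟩ := hc
          have ih := eval_lieTermsK x hD F V N hrec
          have eA := eval_keyedZ x (D := D₁) (n := n) (by omega) _ hA hokA
          have eB := eval_keyedZ x (D := D₂) (n := n) (by omega) _ hB hokB
          rw [toZ_append, ZTerms.eval_append, ih, eval_prodS x hD hkB A hkA, eA, eB, sum_range_succ,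
            Poly.eval_norm, Poly.eval_mul]
          ring

/-- **Soundness of the keyed Lie link**: `lieCheckK b n D₁ D₂ ΛA ΛB F V Rp N = true` with `numVars V = N` and
`0 < ΛA·ΛB` gives `eval (lieDeriv F V) = − eval Rp` on every field of characteristic zero.
[cite: BlekhermanParriloThomas2012, §3.1.4 eq. (3.12), p. 64] -/
theorem eval_lieDeriv_eq_neg_of_lieCheckK (x : ℕ → R) {b n D₁ D₂ ΛA ΛB N : ℕ} {F : List Poly} {V Rp : Poly}
    (h : lieCheckK b n D₁ D₂ ΛA ΛB F V Rp N = true) (hN : Poly.numVars V = N) (hΛ : 0 < ΛA * ΛB) :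
    Poly.eval x (Poly.lieDeriv F V) = -Poly.eval x Rp := by
  unfold lieCheckK at h
  simp only [Bool.and_eq_true, decide_eq_true_eq] at h
  obtain ⟨⟨hD, hokR⟩, hm⟩ := h
  cases hE : lieTermsK b n D₁ D₂ ΛA ΛB F V N with
  | none => rw [hE] at hm; exact absurd hm (by simp)
  | some E =>
    cases hT : keyedZ b (ΛA * ΛB) Rp with
    | none => rw [hE, hT] at hm; exact absurd hm (by simp)
    | some T =>
      rw [hE, hT] at hm
      simp only at hm
      have h0 := eval_eq_of_groupCheck x b n hm
      rw [eval_msortS, toZ_append, ZTerms.eval_append, eval_lieTermsK x hD F V N hE,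
        eval_keyedZ x (D := D₁ + D₂) (n := n) (by omega) Rp hT hokR, STerms.toZ_nil, ZTerms.eval_nil,
        ← hN, ← eval_lieDeriv_eq_sum_mul] at h0
      have hΛ' : ((ΛA : R) * (ΛB : R)) ≠ 0 := by exact_mod_cast hΛ.ne'
      have h1 : (ΛA : R) * (ΛB : R) * (Poly.eval x (Poly.lieDeriv F V) + Poly.eval x Rp) = 0 := by
        push_cast at h0; linear_combination h0
      rcases mul_eq_zero.1 h1 with h2 | h2
      · exact absurd h2 hΛ'
      · linear_combination h2

end Sound

/-- **The curve-form Lyapunov hypothesis from the keyed link**: along every coordinatewise solution `w` of the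
recast field `Fp` (`Fp.length ≤ N'`), `τ ↦ V.eval (…(w τ))` has derivative `−Rp.eval (…(w t))` within `s` at `t`.
[cite: RoucheHabetsLaloy1977, Ch. I §3.1 eq. (3.1)] -/
theorem hasDerivWithinAt_eval_neg_of_lieCheckK {N' : ℕ} {Fp : List Poly} (hFN : Fp.length ≤ N')
    {b n D₁ D₂ ΛA ΛB N : ℕ} {V Rp : Poly} (h : lieCheckK b n D₁ D₂ ΛA ΛB Fp V Rp N = true)
    (hN : Poly.numVars V = N) (hΛ : 0 < ΛA * ΛB)
    {w : ℝ → Fin N' → ℝ} {s : Set ℝ} {t : ℝ}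
    (hw : ∀ i : Fin N', HasDerivWithinAt (fun τ => w τ i)
      (Poly.eval (vars (List.ofFn (w t))) (Fp.getD i [])) s t) :
    HasDerivWithinAt (fun τ => Poly.eval (vars (List.ofFn (w τ))) V)
      (-Poly.eval (vars (List.ofFn (w t))) Rp) s t := by
  rw [← eval_lieDeriv_eq_neg_of_lieCheckK (vars (List.ofFn (w t))) h hN hΛ]
  exact hasDerivWithinAt_eval_lieDeriv_fin hFN V hw

/-- Test (kernel): `V = x₀² + x₀x₁`, `F = (x₁, −x₀)`: `V̇ = 2x₀x₁ + x₁² − x₀²`; with `Rp = −V̇` the keyed link passes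
(base 16, 2 variables, digit bounds 2 and 1, unit scalings). -/
example : lieCheckK 16 2 2 1 1 1 [[(([0, 1] : List ℕ), (1 : ℚ))], [(([1] : List ℕ), (-1 : ℚ))]]
    [(([1, 1] : List ℕ), (1 : ℚ)), (([2] : List ℕ), (1 : ℚ))]
    [(([1, 1] : List ℕ), (-2 : ℚ)), (([0, 2] : List ℕ), (-1 : ℚ)), (([2, 0] : List ℕ), (1 : ℚ))] 2 = true := by
  decide +kernel

end Summit.Ventures.GridStability.Lyapunov.PolyRecast

end
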